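import Summits.HodgeConjecture.HodgeConjecture.Theorems.F0P3cStCharTSXIGData          -- ★ p850103 (this seat) «XIG-DATA★» core: tokens `w₀`, `b′`, `Sn`, conj ①; brings ★ K0WeylG, ★ `CMBorelWeylTorusConjugate`
import Literature.NumberTheory.Rogawski1990.LocalEndoscopicDockSeparation              -- ★ `coe_coe_endoEmbLocal_eq` (the matrix `(g₀₀ 0 g₀₁; 0 u 0; g₁₀ 0 g₁₁)` of `ι_v`)
import Literature.NumberTheory.Automorphic.CMBorelWeylTorusConjugateTwo                -- ★ `weylConj_mem_cmTorus_two` (`w₂ t w₂⁻¹ ∈ T₂`)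
import HarnessLib

/-!
# F0 · P3c · line LH6 «StCharTS» — road (D) «DEEP-FL», «FLIP-REP★»: the embedded `H`-Weyl element IS the `G`-Weyl element of ★ XIG-DATA, and the DOMINANT-side twin of the
# reps-on-the-shell conjunct ① — `Ψ₀(u♭) ∈ (z 𝓘.aᵐ)·S_n` for the flip `u♭ = (w₂ u.1 w₂⁻¹, u.2)` of every oriented representative `u`

Cell `pub/hodgecm-mathlib`, crux H413 = `stmt-HodgeConjecture-24833` (lane `--supports … --as helper`), route HCCMUnconditional; seat LH6-p03 (g2); asked by LH6-p02 (g2) «KAPPA-RATIO★»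
sheet `F0/P3b/LH6-p02/g2/KAPPA-RATIO.sheet.v1.md` (c727433790841ad4) §0 (Q-flip), road (D) owner LH6-p04 (g3).  THEOREMS ONLY, sorry-free, ★-only imports; no definition ∕ instance ∕
notation ∕ named fact.  HONEST LABEL: HC_CM is proved only modulo the 7 printed citations (2 remaining: hLiu418 = stmt-HodgeConjecture-24832, h413 = stmt-HodgeConjecture-24833) until
rung 0 closes; count-neutral plumbing of road (D).

THE MATHEMATICS ([Rogawski1990, §4.8 Case (a) p. 53; §12.7 L. 12.7.3 (proof) p. 195]).  `ι_v(h₂, h₁)` carries the `U(Φ₂)`-block on the coordinates `{0, 2}` and `h₁` on `{1}` (★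
`coe_coe_endoEmbLocal_eq`), so `ι_v(w₂, 1)` — `w₂` the long Weyl element of `U(Φ₂)` (matrix `Φ₂`) — has matrix `Φ₃`: it IS the long Weyl element `w₀` of `U(Φ₃)` that ★ XIG-DATA used to
flip the base (`b′ = w₀ b w₀⁻¹`, `b = z 𝓘.aᵐ`).  Hence for an oriented representative `u` with `ι_v(u) = b′ s`, `s ∈ S_n` (conj ①): `ι_v(u♭) = w₀ ι_v(u) w₀⁻¹ = b · (w₀ s w₀⁻¹)` with
`w₀ s w₀⁻¹ ∈ S_n` (`w₀` normalises `K_n`, ★ K0-WEYL-G `hKw`; `w₀ T₃ w₀⁻¹ = T₃`; `w₀² = 1`) — the `hrep` slot of ★ p850018 at the DOMINANT points `h u := w₂ u.1 w₂⁻¹`, `b′ := ⟨z 𝓘.aᵐ, hbM⟩`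
(KAPPA-RATIO §0: the Steinberg exponent sits at the dominant flip).

## References
* [Rogawski1990] J. D. Rogawski, *Automorphic Representations of Unitary Groups in Three Variables*, Ann. of Math. Stud. 123 (1990): §4.8 Case (a) p. 53; §1.10 p. 9; §12.7
  Lemma 12.7.3 (proof) p. 195.
-/

set_option autoImplicit false
-- the mandated namespace has the single-problem summit's repeated segment (`HodgeConjecture.HodgeConjecture`)
set_option linter.dupNamespace false

noncomputable section

open Matrix NumberField IsDedekindDomain
open scoped MatrixGroups Pointwise
open Literature.NumberTheory.Rogawski1990 Literature.NumberTheory.Automorphic Literature.NumberTheory.Automorphic.UnitaryGroup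
open Literature.NumberTheory.GaloisRepresentations

namespace Summit.HodgeConjecture.HodgeConjecture.Cruxes.H413.F0P3cStCharTSXIGDataFlip

variable (L : Type) [Field L] [NumberField L] [IsCMField L] (v : HeightOneSpectrum (𝓞 ↥(maximalRealSubfield L)))

/-! ## §1 `ι_v(w₂, 1) = w₀` -/

/-- The `(* 0 *; 0 1 0; * 0 *)`-pattern of `Φ₂` is `Φ₃`. [cite: Rogawski1990, §4.8 Case (a) p. 53] -/
theorem endoPattern_antidiagonal_two {K : Type*} [CommRing K] :
    (!![((StdForm.antidiagonal 2).over K) 0 0, 0, ((StdForm.antidiagonal 2).over K) 0 1; 0, 1, 0;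
        ((StdForm.antidiagonal 2).over K) 1 0, 0, ((StdForm.antidiagonal 2).over K) 1 1] : Matrix (Fin 3) (Fin 3) K) =
      (StdForm.antidiagonal 3).over K := by
  ext i j
  fin_cases i <;> fin_cases j <;> simp [StdForm.antidiagonal_over_apply, Fin.rev, Fin.ext_iff]

/-- **The embedded `H`-Weyl element is the `G`-Weyl element**: for `w₂ ∈ U(Φ₂)(L⁺_v)` with matrix `Φ₂` and `w₀ ∈ U(Φ₃)(L⁺_v)` with matrix `Φ₃`, `ι_v(w₂, 1) = w₀` (both have matrix
`Φ₃`: the `{0,2}`-block of `ι_v(w₂, 1)` is `Φ₂`, its `(1,1)` entry is `1`; ★ `coe_coe_endoEmbLocal_eq`). [cite: Rogawski1990, §4.8 Case (a) p. 53; §1.10 p. 9] -/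
theorem endoEmbLocal_weylElt_eq
    (w₂ : ↥(unitaryGroupOfForm (conjLocal L (IsCMField.complexConj L) v) (cmLocalForm L 2 v)))
    (hw₂ : Units.val (w₂ : GL (Fin 2) (LocalRing L v)) = cmLocalForm L 2 v)
    (w₀ : ↥(unitaryGroupOfForm (conjLocal L (IsCMField.complexConj L) v) (cmLocalForm L 3 v)))
    (hw₀ : Units.val (w₀ : GL (Fin 3) (LocalRing L v)) = cmLocalForm L 3 v) :
    endoEmbLocal L v ((w₂, 1) : ↥(unitaryGroupOfForm (conjLocal L (IsCMField.complexConj L) v) (cmLocalForm L 2 v)) ×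
        (cmDatum L 1 (Matrix.of fun i j : Fin 1 => if i.val + j.val + 1 = 1 then (1 : L) else 0)).Local v) = w₀ := by
  have h2 : Units.val (w₂ : GL (Fin 2) (LocalRing L v)) = (StdForm.antidiagonal 2).over (LocalRing L v) := by
    rw [hw₂, cmLocalForm_eq_over]
  have h3 : Units.val (w₀ : GL (Fin 3) (LocalRing L v)) = (StdForm.antidiagonal 3).over (LocalRing L v) := by
    rw [hw₀, cmLocalForm_eq_over]
  have hγ : finGammaTwo L v ((w₂, 1) : ↥(unitaryGroupOfForm (conjLocal L (IsCMField.complexConj L) v) (cmLocalForm L 2 v)) ×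
        (cmDatum L 1 (Matrix.of fun i j : Fin 1 => if i.val + j.val + 1 = 1 then (1 : L) else 0)).Local v) = 1 := by
    unfold finGammaTwo
    change (1 : Matrix (Fin 1) (Fin 1) (LocalRing L v)) 0 0 = 1
    exact Matrix.one_apply_eq 0
  apply Subtype.ext
  apply Units.ext
  have key : (((endoEmbLocal L v ((w₂, 1) : ↥(unitaryGroupOfForm (conjLocal L (IsCMField.complexConj L) v) (cmLocalForm L 2 v)) ×
      (cmDatum L 1 (Matrix.of fun i j : Fin 1 => if i.val + j.val + 1 = 1 then (1 : L) else 0)).Local v)).val : GL (Fin 3) (LocalRing L v)).val :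
        Matrix (Fin 3) (Fin 3) (LocalRing L v)) =
      !![Units.val (w₂ : GL (Fin 2) (LocalRing L v)) 0 0, 0, Units.val (w₂ : GL (Fin 2) (LocalRing L v)) 0 1;
        0, finGammaTwo L v ((w₂, 1) : ↥(unitaryGroupOfForm (conjLocal L (IsCMField.complexConj L) v) (cmLocalForm L 2 v)) ×
          (cmDatum L 1 (Matrix.of fun i j : Fin 1 => if i.val + j.val + 1 = 1 then (1 : L) else 0)).Local v), 0;
        Units.val (w₂ : GL (Fin 2) (LocalRing L v)) 1 0, 0, Units.val (w₂ : GL (Fin 2) (LocalRing L v)) 1 1] :=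
    coe_coe_endoEmbLocal_eq (L := L) (v := v) _
  change (((endoEmbLocal L v ((w₂, 1) : ↥(unitaryGroupOfForm (conjLocal L (IsCMField.complexConj L) v) (cmLocalForm L 2 v)) ×
      (cmDatum L 1 (Matrix.of fun i j : Fin 1 => if i.val + j.val + 1 = 1 then (1 : L) else 0)).Local v)).val : GL (Fin 3) (LocalRing L v)).val :
        Matrix (Fin 3) (Fin 3) (LocalRing L v)) = Units.val (w₀ : GL (Fin 3) (LocalRing L v))
  rw [key, hγ, h2, endoPattern_antidiagonal_two, h3]

/-! ## §2 The dominant-side twin of conj ① -/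

set_option maxHeartbeats 1600000 in  -- statement-level `whnf` on the CM carriers (same class as ★ `hflip_of_antiOriented`)
/-- **«FLIP-REP★».**  `w₀ ∈ U(Φ₃)` with matrix `Φ₃` normalising `K_n` (★ XIG-DATA's `w₀`, `hKw`), `w₂ ∈ U(Φ₂)` with matrix `Φ₂`, `b ∈ T₃`, `↑b′ = w₀ b w₀⁻¹`, `S_n = K_n ∩ T₃`.  If `ι_v(u) ∈ b′·S_n`
(conj ① at `u`), then `ι_v(w₂ u.1 w₂⁻¹, u.2) ∈ b·S_n` — precisely: `∃ t ∈ ⟨b, hbM⟩ • ↑S_n, ↑t = ι_v(w₂ ↑u.1 w₂⁻¹, u.2)`. [cite: Rogawski1990, §4.8 Case (a) p. 53; §12.7 Lemma 12.7.3 (proof) p. 195] -/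
theorem exists_mem_smul_flip_of_rep (𝓘 : (cmBorelTriple L 3 v).IwahoriDatum) (n : ℕ)
    (w₀ : ↥(unitaryGroupOfForm (conjLocal L (IsCMField.complexConj L) v) (cmLocalForm L 3 v)))
    (hw₀ : Units.val (w₀ : GL (Fin 3) (LocalRing L v)) = cmLocalForm L 3 v) (hKw : ∀ κ ∈ 𝓘.K n, w₀ * κ * w₀⁻¹ ∈ 𝓘.K n)
    (w₂ : ↥(unitaryGroupOfForm (conjLocal L (IsCMField.complexConj L) v) (cmLocalForm L 2 v)))
    (hw₂ : Units.val (w₂ : GL (Fin 2) (LocalRing L v)) = cmLocalForm L 2 v)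
    {b : ↥(unitaryGroupOfForm (conjLocal L (IsCMField.complexConj L) v) (cmLocalForm L 3 v))} (hbM : b ∈ (cmBorelTriple L 3 v).M)
    (b' : ↥(cmBorelTriple L 3 v).M) (hb' : (b' : ↥(unitaryGroupOfForm (conjLocal L (IsCMField.complexConj L) v) (cmLocalForm L 3 v))) = w₀ * b * w₀⁻¹)
    (Sn : Subgroup ↥(cmBorelTriple L 3 v).M) (hSn : Sn = (𝓘.K n).subgroupOf (cmBorelTriple L 3 v).M)
    (u : ↥(cmBorelTriple L 2 v).M × (cmDatum L 1 (Matrix.of fun i j : Fin 1 => if i.val + j.val + 1 = 1 then (1 : L) else 0)).Local v)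
    (hu : ∃ t ∈ b' • (Sn : Set ↥(cmBorelTriple L 3 v).M),
      (t : ↥(unitaryGroupOfForm (conjLocal L (IsCMField.complexConj L) v) (cmLocalForm L 3 v))) =
        endoEmbLocal L v ((u.1 : ↥(unitaryGroupOfForm (conjLocal L (IsCMField.complexConj L) v) (cmLocalForm L 2 v))), u.2)) :
    ∃ t ∈ (⟨b, hbM⟩ : ↥(cmBorelTriple L 3 v).M) • (Sn : Set ↥(cmBorelTriple L 3 v).M),
      (t : ↥(unitaryGroupOfForm (conjLocal L (IsCMField.complexConj L) v) (cmLocalForm L 3 v))) =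
        endoEmbLocal L v (w₂ * (u.1 : ↥(unitaryGroupOfForm (conjLocal L (IsCMField.complexConj L) v) (cmLocalForm L 2 v))) * w₂⁻¹, u.2) := by
  obtain ⟨t, ht, htu⟩ := hu
  obtain ⟨s, hs, hts⟩ := Set.mem_smul_set.1 ht
  -- `w₀² = 1`
  have hww : w₀ * w₀ = 1 := by
    apply Subtype.ext
    apply Units.ext
    rw [Subgroup.coe_mul, Units.val_mul, hw₀, Subgroup.coe_one, Units.val_one, cmLocalForm_eq_over, StdForm.over_mul_over]
  have hwinv : w₀⁻¹ = w₀ := inv_eq_of_mul_eq_one_right hww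
  -- the conjugated shell element `w₀ s w₀⁻¹ ∈ S_n`
  have hsK : ((s : ↥(cmBorelTriple L 3 v).M) : ↥(unitaryGroupOfForm (conjLocal L (IsCMField.complexConj L) v) (cmLocalForm L 3 v))) ∈ 𝓘.K n := by
    rw [hSn] at hs; exact Subgroup.mem_subgroupOf.1 hs
  have hs'M : w₀ * ((s : ↥(cmBorelTriple L 3 v).M) : ↥(unitaryGroupOfForm (conjLocal L (IsCMField.complexConj L) v) (cmLocalForm L 3 v))) * w₀⁻¹ ∈ (cmBorelTriple L 3 v).M :=
    weylConj_mem_cmTorus L v w₀ hw₀ ⟨(s : ↥(unitaryGroupOfForm (conjLocal L (IsCMField.complexConj L) v) (cmLocalForm L 3 v))), s.2⟩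
  have hs'Sn : (⟨_, hs'M⟩ : ↥(cmBorelTriple L 3 v).M) ∈ Sn := by
    rw [hSn]; exact Subgroup.mem_subgroupOf.2 (hKw _ hsK)
  refine ⟨(⟨b, hbM⟩ : ↥(cmBorelTriple L 3 v).M) • (⟨_, hs'M⟩ : ↥(cmBorelTriple L 3 v).M), Set.smul_mem_smul_set hs'Sn, ?_⟩
  -- everything is read in `GL₃(∏ L_w)` (one concrete group: `ι_v(x).val = endoGL (x.1.val, x.2.val)` definitionally, ★ `coe_endoEmbLocal`)
  have hwwG : (w₀ : GL (Fin 3) (LocalRing L v)) * (w₀ : GL (Fin 3) (LocalRing L v)) = 1 := by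
    rw [← Subgroup.coe_mul, hww, Subgroup.coe_one]
  have hwinvG : (w₀ : GL (Fin 3) (LocalRing L v))⁻¹ = (w₀ : GL (Fin 3) (LocalRing L v)) := inv_eq_of_mul_eq_one_right hwwG
  have hb'G : (((b' : ↥(cmBorelTriple L 3 v).M) : ↥(unitaryGroupOfForm (conjLocal L (IsCMField.complexConj L) v) (cmLocalForm L 3 v))) : GL (Fin 3) (LocalRing L v)) =
      (w₀ : GL (Fin 3) (LocalRing L v)) * (b : GL (Fin 3) (LocalRing L v)) * (w₀ : GL (Fin 3) (LocalRing L v))⁻¹ := by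
    rw [hb', Subgroup.coe_mul, Subgroup.coe_mul, Subgroup.coe_inv]
  have htsG : (((t : ↥(cmBorelTriple L 3 v).M) : ↥(unitaryGroupOfForm (conjLocal L (IsCMField.complexConj L) v) (cmLocalForm L 3 v))) : GL (Fin 3) (LocalRing L v)) =
      (((b' : ↥(cmBorelTriple L 3 v).M) : ↥(unitaryGroupOfForm (conjLocal L (IsCMField.complexConj L) v) (cmLocalForm L 3 v))) : GL (Fin 3) (LocalRing L v)) *
        (((s : ↥(cmBorelTriple L 3 v).M) : ↥(unitaryGroupOfForm (conjLocal L (IsCMField.complexConj L) v) (cmLocalForm L 3 v))) : GL (Fin 3) (LocalRing L v)) := by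
    rw [← hts, smul_eq_mul, Subgroup.coe_mul, Subgroup.coe_mul]
  have htuG : (((t : ↥(cmBorelTriple L 3 v).M) : ↥(unitaryGroupOfForm (conjLocal L (IsCMField.complexConj L) v) (cmLocalForm L 3 v))) : GL (Fin 3) (LocalRing L v)) =
      endoGL (((u.1 : ↥(unitaryGroupOfForm (conjLocal L (IsCMField.complexConj L) v) (cmLocalForm L 2 v))) : GL (Fin 2) (LocalRing L v)),
        (u.2.val : GL (Fin 1) (LocalRing L v))) := by
    rw [htu]; rfl
  have hw₀G : (w₀ : GL (Fin 3) (LocalRing L v)) = endoGL ((w₂ : GL (Fin 2) (LocalRing L v)), (1 : GL (Fin 1) (LocalRing L v))) := by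
    rw [← endoEmbLocal_weylElt_eq L v w₂ hw₂ w₀ hw₀]; rfl
  have hR : ((endoEmbLocal L v (w₂ * (u.1 : ↥(unitaryGroupOfForm (conjLocal L (IsCMField.complexConj L) v) (cmLocalForm L 2 v))) * w₂⁻¹, u.2)).val :
        GL (Fin 3) (LocalRing L v)) =
      endoGL ((w₂ : GL (Fin 2) (LocalRing L v)), (1 : GL (Fin 1) (LocalRing L v))) *
        endoGL (((u.1 : ↥(unitaryGroupOfForm (conjLocal L (IsCMField.complexConj L) v) (cmLocalForm L 2 v))) : GL (Fin 2) (LocalRing L v)),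
          (u.2.val : GL (Fin 1) (LocalRing L v))) *
        (endoGL ((w₂ : GL (Fin 2) (LocalRing L v)), (1 : GL (Fin 1) (LocalRing L v))))⁻¹ := by
    rw [← map_inv, ← map_mul, ← map_mul, Prod.inv_mk, inv_one, Prod.mk_mul_mk, Prod.mk_mul_mk, one_mul, mul_one]
    rfl
  apply Subtype.ext
  rw [smul_eq_mul, Subgroup.coe_mul]
  change (b : GL (Fin 3) (LocalRing L v)) * (((w₀ * ((s : ↥(cmBorelTriple L 3 v).M) : ↥(unitaryGroupOfForm (conjLocal L (IsCMField.complexConj L) v) (cmLocalForm L 3 v))) * w₀⁻¹ :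
      ↥(unitaryGroupOfForm (conjLocal L (IsCMField.complexConj L) v) (cmLocalForm L 3 v))) : GL (Fin 3) (LocalRing L v))) = _
  rw [Subgroup.coe_mul, Subgroup.coe_mul, Subgroup.coe_inv, hR, ← hw₀G, ← htuG, htsG, hb'G, hwinvG]
  simp only [← mul_assoc, hwwG, one_mul]

set_option maxHeartbeats 1600000 in  -- statement-level `whnf` on the CM carriers
/-- **«FLIP-REP★» for the whole cover** — the `hrep` slot of ★ p850018 `steinbergLabel_smoothTrace_sum_eq_cmXiTorusChar` at the DOMINANT points: with `h u := ⟨w₂ ↑u.1 w₂⁻¹, _⟩`,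
`z u := u.2`, `b′ := ⟨z 𝓘.aᵐ, hbM⟩`, `Sn :=` ★ XIG-DATA's, from ★ XIG-DATA's conj ① (`hrep`). [cite: Rogawski1990, §4.8 Case (a) p. 53; §12.7 Lemma 12.7.3 (proof) p. 195] -/
theorem forall_exists_mem_smul_flip_of_cover (𝓘 : (cmBorelTriple L 3 v).IwahoriDatum) (n : ℕ)
    (w₀ : ↥(unitaryGroupOfForm (conjLocal L (IsCMField.complexConj L) v) (cmLocalForm L 3 v)))
    (hw₀ : Units.val (w₀ : GL (Fin 3) (LocalRing L v)) = cmLocalForm L 3 v) (hKw : ∀ κ ∈ 𝓘.K n, w₀ * κ * w₀⁻¹ ∈ 𝓘.K n)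
    (w₂ : ↥(unitaryGroupOfForm (conjLocal L (IsCMField.complexConj L) v) (cmLocalForm L 2 v)))
    (hw₂ : Units.val (w₂ : GL (Fin 2) (LocalRing L v)) = cmLocalForm L 2 v)
    {b : ↥(unitaryGroupOfForm (conjLocal L (IsCMField.complexConj L) v) (cmLocalForm L 3 v))} (hbM : b ∈ (cmBorelTriple L 3 v).M)
    (b' : ↥(cmBorelTriple L 3 v).M) (hb' : (b' : ↥(unitaryGroupOfForm (conjLocal L (IsCMField.complexConj L) v) (cmLocalForm L 3 v))) = w₀ * b * w₀⁻¹)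
    (Sn : Subgroup ↥(cmBorelTriple L 3 v).M) (hSn : Sn = (𝓘.K n).subgroupOf (cmBorelTriple L 3 v).M)
    (F : Finset (↥(cmBorelTriple L 2 v).M × (cmDatum L 1 (Matrix.of fun i j : Fin 1 => if i.val + j.val + 1 = 1 then (1 : L) else 0)).Local v))
    (hF : ∀ u ∈ F, ∃ t ∈ b' • (Sn : Set ↥(cmBorelTriple L 3 v).M),
      (t : ↥(unitaryGroupOfForm (conjLocal L (IsCMField.complexConj L) v) (cmLocalForm L 3 v))) =
        endoEmbLocal L v ((u.1 : ↥(unitaryGroupOfForm (conjLocal L (IsCMField.complexConj L) v) (cmLocalForm L 2 v))), u.2)) :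
    ∀ u ∈ F, ∃ t ∈ (⟨b, hbM⟩ : ↥(cmBorelTriple L 3 v).M) • (Sn : Set ↥(cmBorelTriple L 3 v).M),
      (t : ↥(unitaryGroupOfForm (conjLocal L (IsCMField.complexConj L) v) (cmLocalForm L 3 v))) =
        endoEmbLocal L v
          (((⟨w₂ * (u.1 : ↥(unitaryGroupOfForm (conjLocal L (IsCMField.complexConj L) v) (cmLocalForm L 2 v))) * w₂⁻¹, weylConj_mem_cmTorus_two L v w₂ hw₂ u.1⟩ :
              ↥(cmBorelTriple L 2 v).M) : ↥(unitaryGroupOfForm (conjLocal L (IsCMField.complexConj L) v) (cmLocalForm L 2 v))), u.2) :=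
  fun u hu => exists_mem_smul_flip_of_rep L v 𝓘 n w₀ hw₀ hKw w₂ hw₂ hbM b' hb' Sn hSn u (hF u hu)

end Summit.HodgeConjecture.HodgeConjecture.Cruxes.H413.F0P3cStCharTSXIGDataFlip

end
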